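import Mathlib
import HarnessLib
import Summits.HubbardSuperconductivity.HubbardSuperconductivity.Theorems.KLProgrammeC4aPartnerBandTangencyDefectSharp
import Summits.HubbardSuperconductivity.HubbardSuperconductivity.Theorems.KLProgrammeC4aRadialRowsAll

/-!
# Route `KLProgramme` — crux C4a, S3 brick (B2, TANGENCY, EVERY ORDER `k ≤ 4` UNCONDITIONAL): the co-moving jets of the pp / ph partner band
# near tangency, core + reductions, with ALL radial rows discharged by `…C4aRadialRowsAll`

Cell `gate-hubbard-kl`, seat hubbard-kl-k3c3-p3 (g23; row «implicit-function / monotonicity route»).  Located brick «(B2)-TAN-ALL», CLOSING FILE for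
C4A-PLAN §24.8/§24.9 «orders 3–4 at (T)» of the (C)-closer lane hubbard-kl-c4a-1 (stub (C) `stub_twoLeg_curvature` of `KLRegimeEngineV17F2`,
stmt-HubbardSuperconductivity-20437).  The sharp assembly `abs_iteratedDeriv_partnerBand_pp/ph_tangency_le_sharp` needs the radial rows
`‖Φ_x⁽ⁱ⁾ − Φ_0⁽ⁱ⁾‖ ≤ RRᵢ·|x|`, `i ≤ k`; `norm_iteratedDeriv_levelPoint_sub_le_of_table` supplies them at EVERY order with
`RRᵢ = Σ_{j≤i} C(i,j)·Q j` for any table `Q` closing the reciprocal recursion of the radial slope.  Hence, for every `k ≤ 4`: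

* **`abs_iteratedDeriv_partnerBand_pp_tangency_le_of_table`** — `|∂ᵏ_t|₀ e_K(S_{ρϑθ}(t) − Φ(e,φ+θ+t))| ≤ (k+2)!·𝒦·(3𝒟)^{k+2}·φ² +
  |e|·(k+1)!·𝒦·R₁·D₁ᵏ + (|ρ|+|ϑ|)·(k+1)!·𝒦·R₂·D₂ᵏ`;
* **`abs_iteratedDeriv_partnerBand_ph_tangency_le_of_table`** — the ph twin with `|ϑ − π|`;

the hypotheses being inequalities between closed-form expressions in the frame sizes `A, A₃…A₆` (through `𝒦`, `msD6`), `Dt_min − 2A` and the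
user's majorants `𝒟, Q, D₁, R₁, D₂, R₂` only — UNCONDITIONAL, uniform in the frame `K` given its sizes, `n`-free: the input «𝒜 ≲ e + φ² + δ on the
crossing region» of §24.4's power counting near (T), at every order the crux reads (`i ≤ 4`).

Proved bookkeeping on landed objects; nothing about the Hubbard model's sizes; nothing asserts superconductivity.
References: FST II CPAM 51 (1998) §3; BGM 2006 §2.4 Lemma 2.1 (2.40)–(2.41) [cite: BenfattoGiulianiMastropietro2006].
-/

noncomputable section

namespace Summit.HubbardSuperconductivity.HubbardSuperconductivity.Theorems.C4a

set_option linter.dupNamespace false -- summit = problem name (single-conjunct summit), D-0017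

open Real Set Filter Finset
open scoped Topology
open Literature.MathematicalPhysics.QuantumLattice Literature.MathematicalPhysics.QuantumLattice.BandSectorCounting Literature.Probability.LatticeModels
open Summit.HubbardSuperconductivity.HubbardSuperconductivity.Theorems.KLRegimeSplit
open Summit.HubbardSuperconductivity.HubbardSuperconductivity.Theorems.DispersionFlow
open Summit.HubbardSuperconductivity.HubbardSuperconductivity.Theorems.PerturbedFermiCurve

section Sizes

variable {K : TrigPolyC4v} {A : ℝ} (hA : ∀ p : Momentum, ∀ j ≤ 2, ‖iteratedFDeriv ℝ j (frameShift K) p‖ ≤ A) (hA20 : A ≤ 1 / 20)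
  (hd : klCurveD ≤ (bandBounds (show (-4 : ℝ) < -1.1 by norm_num) (show (-1.1 : ℝ) ≤ -0.1 by norm_num)
    (show (-0.1 : ℝ) < 0 by norm_num)).Dtmin - 2 * A)
  {μ r : ℝ} (hr : 0 < r) (hlo : (-1.1 : ℝ) < μ - r - A) (hhi : μ + r + A < -0.1)
  {A₃ A₄ A₅ A₆ : ℝ} (hA₃ : ∀ p : Momentum, ‖iteratedFDeriv ℝ 3 (frameShift K) p‖ ≤ A₃)
  (hA₄ : ∀ p : Momentum, ‖iteratedFDeriv ℝ 4 (frameShift K) p‖ ≤ A₄)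
  (hA₅ : ∀ p : Momentum, ‖iteratedFDeriv ℝ 5 (frameShift K) p‖ ≤ A₅)
  (hA₆ : ∀ p : Momentum, ‖iteratedFDeriv ℝ 6 (frameShift K) p‖ ≤ A₆)
include hA hA20 hd hr hlo hhi hA₃ hA₄ hA₅ hA₆

/-- **The rows of `…C4aRadialRowsAll` as a row majorant for the sharp files**: for `k ≤ 5`, `RRᵢ := Σ_{j≤i} C(i,j)·Q j` bounds
`‖Φ_x⁽ⁱ⁾ − Φ_0⁽ⁱ⁾‖/|x|` for `i ≤ k`, and is nonnegative there. -/
theorem radialRows_of_table {k : ℕ} (hk : k ≤ 5) {𝒦 𝒟 : ℝ}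
    (hK : ∀ m, 1 ≤ m → m ≤ k + 1 → ∀ p : Momentum, ‖iteratedFDeriv ℝ m (frameLevel μ K) p‖ ≤ 𝒦) (h𝒟 : 1 ≤ 𝒟)
    (hD : ∀ j, 1 ≤ j → j ≤ k → msD6 A₃ A₄ A₅ A₆ j ≤ 𝒟 ^ j) {Q : ℕ → ℝ}
    (hQ0 : ((bandBounds (show (-4 : ℝ) < -1.1 by norm_num) (show (-1.1 : ℝ) ≤ -0.1 by norm_num) (show (-0.1 : ℝ) < 0 by norm_num)).Dtmin - 2 * A)⁻¹ ≤ Q 0)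
    (hQ : ∀ m, 1 ≤ m → m ≤ k → ((bandBounds (show (-4 : ℝ) < -1.1 by norm_num) (show (-1.1 : ℝ) ≤ -0.1 by norm_num)
        (show (-0.1 : ℝ) < 0 by norm_num)).Dtmin - 2 * A)⁻¹ *
        ∑ j ∈ Finset.range m, (m.choose j : ℝ) * Q j * ((m - j + 1).factorial * 𝒦 * 𝒟 ^ (m - j)) ≤ Q m) :
    (∀ {x : ℝ}, |x| < r → ∀ i, i ≤ k → ∀ s, ‖iteratedDeriv i (levelPoint μ K x) s - iteratedDeriv i (levelPoint μ K 0) s‖ ≤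
        (∑ j ∈ Finset.range (i + 1), (i.choose j : ℝ) * Q j) * |x|) ∧
      ∀ i, i ≤ k → 0 ≤ ∑ j ∈ Finset.range (i + 1), (i.choose j : ℝ) * Q j := by
  have hrows : ∀ {x : ℝ}, |x| < r → ∀ i, i ≤ k → ∀ s, ‖iteratedDeriv i (levelPoint μ K x) s - iteratedDeriv i (levelPoint μ K 0) s‖ ≤
      (∑ j ∈ Finset.range (i + 1), (i.choose j : ℝ) * Q j) * |x| := fun hx i hi s =>
    norm_iteratedDeriv_levelPoint_sub_le_of_table hA hA20 hd hlo hhi hA₃ hA₄ hA₅ hA₆ hk hK h𝒟 hD hQ0 hQ hx hi s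
  refine ⟨hrows, fun i hi => ?_⟩
  have hx : |r / 2| < r := by rw [abs_of_pos (by positivity)]; linarith
  have h := (norm_nonneg _).trans (hrows hx i hi 0)
  have hpos : 0 < |r / 2| := by rw [abs_of_pos (by positivity)]; positivity
  nlinarith

/-- **THE `k`-TH CO-MOVING JET OF THE pp PARTNER BAND NEAR TANGENCY, EVERY `k ≤ 4`, UNCONDITIONAL.**  Band rows `‖Dⁱe_K‖ ≤ 𝒦` (`1 ≤ i ≤ k+2`),
curve base `1 ≤ 𝒟`, `msD6 i ≤ 𝒟ⁱ` (`1 ≤ i ≤ k+2`), reciprocal table `Q` (`d⁻¹ ≤ Q 0`, `d⁻¹·Σ_{j<m} C(m,j)·Q j·((m−j+1)!·𝒦·𝒟^{m−j}) ≤ Q m`,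
`1 ≤ m ≤ k`, `d = Dt_min − 2A`), rows `RRᵢ := Σ_{j≤i} C(i,j)·Q j`, and bases with `3·msD6 j + |e|·RRⱼ ≤ D₁ʲ`, `RRⱼ ≤ R₁·D₁ʲ`,
`3·msD6 j + (|ρ|+|ϑ|)·(RRⱼ + msD6 (j+1)) ≤ D₂ʲ`, `RRⱼ + msD6 (j+1) ≤ R₂·D₂ʲ` (`j ≤ k`):
`|∂ᵏ_t|₀ e_K(S_{ρϑθ}(t) − Φ(e,φ+θ+t))| ≤ (k+2)!·𝒦·(3𝒟)^{k+2}·φ² + |e|·(k+1)!·𝒦·R₁·D₁ᵏ + (|ρ|+|ϑ|)·(k+1)!·𝒦·R₂·D₂ᵏ`. -/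
theorem abs_iteratedDeriv_partnerBand_pp_tangency_le_of_table {k : ℕ} (hk : k ≤ 4) {𝒦 𝒟 : ℝ}
    (hK : ∀ i, 1 ≤ i → i ≤ k + 2 → ∀ p : Momentum, ‖iteratedFDeriv ℝ i (frameLevel μ K) p‖ ≤ 𝒦) (h𝒟 : 1 ≤ 𝒟)
    (hD : ∀ i, 1 ≤ i → i ≤ k + 2 → msD6 A₃ A₄ A₅ A₆ i ≤ 𝒟 ^ i) {Q : ℕ → ℝ}
    (hQ0 : ((bandBounds (show (-4 : ℝ) < -1.1 by norm_num) (show (-1.1 : ℝ) ≤ -0.1 by norm_num) (show (-0.1 : ℝ) < 0 by norm_num)).Dtmin - 2 * A)⁻¹ ≤ Q 0)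
    (hQ : ∀ m, 1 ≤ m → m ≤ k → ((bandBounds (show (-4 : ℝ) < -1.1 by norm_num) (show (-1.1 : ℝ) ≤ -0.1 by norm_num)
        (show (-0.1 : ℝ) < 0 by norm_num)).Dtmin - 2 * A)⁻¹ *
        ∑ j ∈ Finset.range m, (m.choose j : ℝ) * Q j * ((m - j + 1).factorial * 𝒦 * 𝒟 ^ (m - j)) ≤ Q m)
    {ρ : ℝ} (hρ : |ρ| < r) {e : ℝ} (he : |e| < r) (ϑ : ℝ) {D₁ R₁ D₂ R₂ : ℝ} (hD₁0 : 0 ≤ D₁) (hR₁0 : 0 ≤ R₁) (hD₂0 : 0 ≤ D₂) (hR₂0 : 0 ≤ R₂)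
    (hD₁ : ∀ j, 1 ≤ j → j ≤ k → 3 * msD6 A₃ A₄ A₅ A₆ j + |e| * (∑ l ∈ Finset.range (j + 1), (j.choose l : ℝ) * Q l) ≤ D₁ ^ j)
    (hR₁ : ∀ j, j ≤ k → (∑ l ∈ Finset.range (j + 1), (j.choose l : ℝ) * Q l) ≤ R₁ * D₁ ^ j)
    (hD₂ : ∀ j, 1 ≤ j → j ≤ k →
      3 * msD6 A₃ A₄ A₅ A₆ j + (|ρ| + |ϑ|) * ((∑ l ∈ Finset.range (j + 1), (j.choose l : ℝ) * Q l) + msD6 A₃ A₄ A₅ A₆ (j + 1)) ≤ D₂ ^ j)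
    (hR₂ : ∀ j, j ≤ k → (∑ l ∈ Finset.range (j + 1), (j.choose l : ℝ) * Q l) + msD6 A₃ A₄ A₅ A₆ (j + 1) ≤ R₂ * D₂ ^ j) (θ φ : ℝ) :
    |iteratedDeriv k (fun t : ℝ => frameLevel μ K (pairSumPath μ K ρ ϑ θ t - levelPoint μ K e (φ + θ + t))) 0| ≤
      (k + 2).factorial * 𝒦 * (3 * 𝒟) ^ (k + 2) * φ ^ 2 + |e| * ((k + 1).factorial * 𝒦 * R₁ * D₁ ^ k) +
        (|ρ| + |ϑ|) * ((k + 1).factorial * 𝒦 * R₂ * D₂ ^ k) := by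
  obtain ⟨hrows, hRR0⟩ := radialRows_of_table hA hA20 hd hr hlo hhi hA₃ hA₄ hA₅ hA₆ (hk.trans (by norm_num))
    (fun m hm1 hm p => hK m hm1 (by omega) p) h𝒟 (fun j hj1 hj => hD j hj1 (by omega)) hQ0 hQ
  exact abs_iteratedDeriv_partnerBand_pp_tangency_le_sharp hA hA20 hd hr hlo hhi hA₃ hA₄ hA₅ hA₆ hk hK hD hρ he hRR0
    (fun i hi s => hrows he i hi s) (fun i hi s => hrows hρ i hi s) ϑ hD₁0 hR₁0 hD₂0 hR₂0 hD₁ hR₁ hD₂ hR₂ θ φ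

/-- **THE `k`-TH CO-MOVING JET OF THE ph PARTNER BAND NEAR `2k_F`, EVERY `k ≤ 4`, UNCONDITIONAL** (same data, `|ϑ − π|`). -/
theorem abs_iteratedDeriv_partnerBand_ph_tangency_le_of_table {k : ℕ} (hk : k ≤ 4) {𝒦 𝒟 : ℝ}
    (hK : ∀ i, 1 ≤ i → i ≤ k + 2 → ∀ p : Momentum, ‖iteratedFDeriv ℝ i (frameLevel μ K) p‖ ≤ 𝒦) (h𝒟 : 1 ≤ 𝒟)
    (hD : ∀ i, 1 ≤ i → i ≤ k + 2 → msD6 A₃ A₄ A₅ A₆ i ≤ 𝒟 ^ i) {Q : ℕ → ℝ}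
    (hQ0 : ((bandBounds (show (-4 : ℝ) < -1.1 by norm_num) (show (-1.1 : ℝ) ≤ -0.1 by norm_num) (show (-0.1 : ℝ) < 0 by norm_num)).Dtmin - 2 * A)⁻¹ ≤ Q 0)
    (hQ : ∀ m, 1 ≤ m → m ≤ k → ((bandBounds (show (-4 : ℝ) < -1.1 by norm_num) (show (-1.1 : ℝ) ≤ -0.1 by norm_num)
        (show (-0.1 : ℝ) < 0 by norm_num)).Dtmin - 2 * A)⁻¹ *
        ∑ j ∈ Finset.range m, (m.choose j : ℝ) * Q j * ((m - j + 1).factorial * 𝒦 * 𝒟 ^ (m - j)) ≤ Q m)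
    {ρ : ℝ} (hρ : |ρ| < r) {e : ℝ} (he : |e| < r) (ϑ : ℝ) {D₁ R₁ D₂ R₂ : ℝ} (hD₁0 : 0 ≤ D₁) (hR₁0 : 0 ≤ R₁) (hD₂0 : 0 ≤ D₂) (hR₂0 : 0 ≤ R₂)
    (hD₁ : ∀ j, 1 ≤ j → j ≤ k → 3 * msD6 A₃ A₄ A₅ A₆ j + |e| * (∑ l ∈ Finset.range (j + 1), (j.choose l : ℝ) * Q l) ≤ D₁ ^ j)
    (hR₁ : ∀ j, j ≤ k → (∑ l ∈ Finset.range (j + 1), (j.choose l : ℝ) * Q l) ≤ R₁ * D₁ ^ j)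
    (hD₂ : ∀ j, 1 ≤ j → j ≤ k →
      3 * msD6 A₃ A₄ A₅ A₆ j + (|ρ| + |ϑ - π|) * ((∑ l ∈ Finset.range (j + 1), (j.choose l : ℝ) * Q l) + msD6 A₃ A₄ A₅ A₆ (j + 1)) ≤ D₂ ^ j)
    (hR₂ : ∀ j, j ≤ k → (∑ l ∈ Finset.range (j + 1), (j.choose l : ℝ) * Q l) + msD6 A₃ A₄ A₅ A₆ (j + 1) ≤ R₂ * D₂ ^ j) (θ φ : ℝ) :
    |iteratedDeriv k (fun t : ℝ => frameLevel μ K (levelPoint μ K e (φ + θ + t) - pairDiffPath μ K ρ ϑ θ t)) 0| ≤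
      (k + 2).factorial * 𝒦 * (3 * 𝒟) ^ (k + 2) * φ ^ 2 + |e| * ((k + 1).factorial * 𝒦 * R₁ * D₁ ^ k) +
        (|ρ| + |ϑ - π|) * ((k + 1).factorial * 𝒦 * R₂ * D₂ ^ k) := by
  obtain ⟨hrows, hRR0⟩ := radialRows_of_table hA hA20 hd hr hlo hhi hA₃ hA₄ hA₅ hA₆ (hk.trans (by norm_num))
    (fun m hm1 hm p => hK m hm1 (by omega) p) h𝒟 (fun j hj1 hj => hD j hj1 (by omega)) hQ0 hQ
  exact abs_iteratedDeriv_partnerBand_ph_tangency_le_sharp hA hA20 hd hr hlo hhi hA₃ hA₄ hA₅ hA₆ hk hK hD hρ he hRR0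
    (fun i hi s => hrows he i hi s) (fun i hi s => hrows hρ i hi s) ϑ hD₁0 hR₁0 hD₂0 hR₂0 hD₁ hR₁ hD₂ hR₂ θ φ

end Sizes

end Summit.HubbardSuperconductivity.HubbardSuperconductivity.Theorems.C4a

end
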